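import Literature.AnabelianGeometry.EtaleTheta.LogDivisorModelTateTower
import Literature.AnabelianGeometry.EtaleTheta.TemperedFrobenioidOfGaloisCoveringRankOnePoint
import Literature.AnabelianGeometry.EtaleTheta.BiKummerThm44SubModelConnectedOfGaloisCovering
import Literature.AnabelianGeometry.EtaleTheta.Discharge.Sec3Def36iOfGaloisCovering
import Literature.AnabelianGeometry.EtaleTheta.Discharge.Sec3OfGaloisCoveringConnectedRealified
import HarnessLib

/-!
# [EtTh] Def 3.6 (ii) at the TATE TOWER: a tempered Frobenioid over the constructed connected Def 3.3 (iii) data of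
# abc-iut-w6-d058's `LogDivisorModel.TateTower` (the model of record), and the `hBinj` / `hFinv` / `hP34Λ` instances there

S. Mochizuki, *The étale theta function and its Frobenioid-theoretic manifestations*, Publ. RIMS **45** (2009)
[MochizukiEtTh2009], §1 p. 12 (the universal combinatorial covering of the Tate curve: an infinite chain of copies of the
projective line, Galois group `ℤ` acting by translation), Def. 3.3 (iii) PDF p. 73, Def. 3.6 (i)(ii) pp. 76–77
[cite: MochizukiEtTh2009, Def 3.6 p.77]; [FrdII] Ex. 1.1 (the `p`-adic Frobenioid).

abc-iut cell, block C / W6, seat abc-iut-w6-d048 (gen 3); L2-lead ruling R311 (2026-08-26T12:06Z): «Def 3.6 (ii)(b) NV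
('exists_FΛ_div_ne') + hBinj / hFinv / hP34Λ theorem INSTANCES at TateTower.model / TateTower.action BY NAME».  CLASS (b)
MODEL / NON-VACUITY instance file; every landed declaration consumed BY NAME (abc-iut-w6-d058's `TateTower.model` /
`.action` / `.cuspLaws` / `.shiftDIV` / `.shearFn` / `.divHom`; this seat's engine `TemperedFrobenioid.ofRankOnePoint`;
abc-iut-w5-d179's `DivisorMonoids.ofGaloisActionConnected_ofRlfZWeak_hBinj`; abc-iut-w6-d058's
`hFinv_rlfZ_ofGaloisActionConnected` / `hP34Λ_rlfZ_ofGaloisActionConnected`).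

THE RANK-ONE POINT OF THE TOWER.  `S₀ := G/G` (`G = Gal(Z_∞/X) = ℤ`), i.e. the Tate curve `X` itself as the one-point
connected covering: `Φ₀(G/G) = Hom_G(pt, Div⁺(Z_∞))` = the TRANSLATION-INVARIANT effective log-divisors on the chain = the
constant ones `n·Σ_j [F_j]` (`≅ ℕ`, `TateTowerFrd.phiZeroTopEquivNat`); `B₀(G/G)` = the shear-invariant functions `ϖ^c U^k`,
`k = 0`, = `⟨ϖ⟩ = F₀(G/G)`; and `n·Σ_j [F_j] = div₀(ϖⁿ)` — so `TateTowerFrd.rankOnePoint : RankOnePoint TateTower.action`.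
CONSEQUENCES: **`TateTowerFrd.temperedFrobenioid R S : TemperedFrobenioid (ofRlfZWeak (ofGaloisActionConnected
TateTower.action TateTower.cuspLaws) hpf) (Discrete PUnit) (treeCatVocab …)`** (+ over `ConnectedPart (BTemp Π)`, every `Π`),
`nonempty_…`; hence the cell's «for every tempered Frobenioid over the constructed connected data» theorems are
NON-VACUOUS AT THE MODEL OF RECORD — tokens: `isFrobenioid_temperedFrobenioid_byName` (w5-d179's hypothesis-free
`isFrobenioid_ofRlfZWeak_ofGaloisActionConnected_of_isOfFSMType` INSTANTIATED), `hBinj_tateTower`,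
`hFinv_tateTower`, `hP34Λ_tateTower` (the Def. 3.6 (i) / Prop. 3.4 (ii) binder theorems instantiated at the tower).
HONEST LABEL: the witness sits over ONE point of `D₀` (the curve `X` itself; `D` one object) — an instantiation witness, not
the tempered Frobenioid of the whole tower `{ℤ/nℤ}`; the tower is w6-d058's combinatorial divisor/Galois skeleton, not a
formal scheme; Def. 4.1 bi-Kummer data are NOT claimed inhabited.  Nothing here bears on [IUTchIII] Cor. 3.12; no side
taken; typed ≠ proved for anything else.
-/

noncomputable section

namespace Literature.AnabelianGeometry.EtaleTheta

open CategoryTheory Opposite Function Literature.AlgebraicGeometry.Frobenioids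
  Literature.AnabelianGeometry.SemiGraphs LogDivisorModel LogDivisorModel.GaloisAction LogDivisorModel.TateTower

namespace TateTowerFrd

/-- `D₀` of the tower at this term: the connected `ℤ`-sets. [cite: MochizukiEtTh2009, Def 3.3 p.73] -/
abbrev D₀ : Type 1 := (isConnectedGSet (G := Multiplicative ℤ)).FullSubcategory

/-- The one-point covering `G/G` — the Tate curve `X` itself. [cite: MochizukiEtTh2009, Def 3.3 p.73] -/
abbrev top : D₀ :=
  ⟨Action.ofMulAction (Multiplicative ℤ) (Multiplicative ℤ ⧸ (⊤ : Subgroup (Multiplicative ℤ))), isConnectedGSet_quotient ⊤⟩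

/-- Its base point. [cite: MochizukiEtTh2009, Def 3.3 p.73] -/
abbrev s₀ : top.obj.V := ((1 : Multiplicative ℤ) : Multiplicative ℤ ⧸ (⊤ : Subgroup (Multiplicative ℤ)))

/-- The Def. 3.3 (iii) data of the connected coverings of the tower (abc-iut-w6-d058). [cite: MochizukiEtTh2009, Def 3.3 p.73] -/
abbrev dm : DivisorMonoids.{1, 0, 0} D₀ := DivisorMonoids.ofGaloisActionConnected TateTower.action TateTower.cuspLaws

/-- Prop. 3.4 (i) (weak-cof) for every `Φ₀(Y)` of the tower (abc-iut-w6-d057's `isPerfFactorialCof_phiZero`).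
[cite: MochizukiEtTh2009, Prop 3.4 p.74] -/
theorem hpf (Y : D₀ᵒᵖ) : IsPerfFactorialCof (dm.Φ₀.obj Y) := isPerfFactorialCof_phiZero TateTower.action Y.unop.obj

/-! ### `Φ₀(G/G) ≅ ℕ`: translation-invariant effective divisors on the chain are constant -/

/-- The multiplicity of a log-divisor of the tower at a prime log-divisor (a copy of `Multiplicative.toAdd` with FIXED carrier
`Multiplicative (Idx → ℤ)`, applying verbatim to `TateTower.model.DIV`). [cite: MochizukiEtTh2009, Def 3.1 p.70] -/
def val (d : Multiplicative (TateTower.Idx → ℤ)) (x : TateTower.Idx) : ℤ := Multiplicative.toAdd d x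

/-- `val` of a product. [cite: MochizukiEtTh2009, Def 3.1 p.70] -/
theorem val_mul (a b : Multiplicative (TateTower.Idx → ℤ)) (x : TateTower.Idx) : val (a * b) x = val a x + val b x := rfl

/-- The constant log-divisor `n·Σ_j [F_j]` of the tower. [cite: MochizukiEtTh2009, Def 3.1 p.70] -/
def constDIV (n : ℤ) : Multiplicative (TateTower.Idx → ℤ) := Multiplicative.ofAdd fun _ => n

/-- `val (constDIV n) x = n`. [cite: MochizukiEtTh2009, Def 3.1 p.70] -/
@[simp] theorem val_constDIV (n : ℤ) (x : TateTower.Idx) : val (constDIV n) x = n := rfl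

/-- Translation fixes the constant log-divisors. [cite: MochizukiEtTh2009, Def 3.3 p.73] -/
theorem shiftDIV_constDIV (t n : ℤ) : shiftDIV t (constDIV n) = constDIV n :=
  Multiplicative.toAdd.injective (funext fun x => by rw [toAdd_shiftDIV]; rfl)

/-- All points of `G/G` coincide. [cite: MochizukiEtTh2009, Def 3.3 p.73] -/
theorem eq_s₀ (s : top.obj.V) : s = s₀ := by
  change @Eq (Multiplicative ℤ ⧸ (⊤ : Subgroup (Multiplicative ℤ))) s s₀
  obtain ⟨a, rfl⟩ := QuotientGroup.mk_surjective s
  exact QuotientGroup.eq.mpr (Subgroup.mem_top _)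

/-- `n·Σ_j [F_j]` is an effective Cartier log-divisor of the tower. [cite: MochizukiEtTh2009, Def 3.1 p.70] -/
theorem constDIV_mem_Divplus (n : ℕ) : (constDIV n : TateTower.model.DIV) ∈ TateTower.model.Divplus :=
  ⟨trivial, fun _ => Int.natCast_nonneg n⟩

/-- The constant effective log-divisor `n·Σ_j [F_j]` as an element of `Φ₀(G/G)` (translation-invariant).
[cite: MochizukiEtTh2009, Def 3.3 p.73] -/
def constPhi (n : ℕ) : TateTower.action.phiZero top.obj :=
  ⟨fun _ => constDIV n, fun _ => constDIV_mem_Divplus n, fun g _ => (shiftDIV_constDIV (Multiplicative.toAdd g) n).symm⟩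

/-- A translation-invariant log-divisor takes the same value on every component. [cite: MochizukiEtTh2009, Def 3.3 p.73] -/
theorem val_apply_inr_eq (φ : TateTower.action.phiZero top.obj) (s : top.obj.V) (n : ℤ) :
    val (φ.1 s) (Sum.inr n) = val (φ.1 s₀) (Sum.inr 0) := by
  have h := φ.2.2 (Multiplicative.ofAdd n) s
  rw [eq_s₀ (top.obj.ρ (Multiplicative.ofAdd n) s), eq_s₀ s] at h
  have h' := congrArg (fun d : Multiplicative (TateTower.Idx → ℤ) => val d (Sum.inr n)) h
  change val (φ.1 s₀) (Sum.inr n) =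
    Multiplicative.toAdd (shiftDIV (Multiplicative.toAdd (Multiplicative.ofAdd n)) (φ.1 s₀)) (Sum.inr n) at h'
  rw [toAdd_shiftDIV, toAdd_ofAdd, shiftIdx_symm_inr, sub_self] at h'
  rw [eq_s₀ s]
  exact h'

/-- The multiplicity of `φ ∈ Φ₀(G/G)` along (any) component, a natural number. [cite: MochizukiEtTh2009, Def 3.3 p.73] -/
def multAt (φ : TateTower.action.phiZero top.obj) : ℕ := Int.toNat (val (φ.1 s₀) (Sum.inr 0))

/-- `φ = (multAt φ)·Σ_j [F_j]`. [cite: MochizukiEtTh2009, Def 3.3 p.73] -/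
theorem eq_constPhi_multAt (φ : TateTower.action.phiZero top.obj) : φ = constPhi (multAt φ) := by
  refine Subtype.ext (funext fun s => Multiplicative.toAdd.injective (funext fun x => ?_))
  rcases x with c | n
  · exact c.elim
  · have h0 : (0 : ℤ) ≤ val (φ.1 s₀) (Sum.inr 0) := (φ.2.1 s₀).2 (Sum.inr 0)
    change val (φ.1 s) (Sum.inr n) = val (constDIV ((multAt φ : ℕ) : ℤ)) (Sum.inr n)
    rw [val_constDIV, val_apply_inr_eq, multAt, Int.toNat_of_nonneg h0]

/-- **`Φ₀(G/G) ≅ ℕ`**: one `Gal(Z_∞/X)`-orbit of prime log-divisors (Rmk. 3.3.1). [cite: MochizukiEtTh2009, Rmk 3.3.1 p.73] -/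
def phiZeroTopEquivNat : TateTower.action.phiZero top.obj ≃* Multiplicative ℕ where
  toFun φ := Multiplicative.ofAdd (multAt φ)
  invFun n := constPhi (Multiplicative.toAdd n)
  left_inv φ := by
    change constPhi (Multiplicative.toAdd (Multiplicative.ofAdd (multAt φ))) = φ
    rw [toAdd_ofAdd]
    exact (eq_constPhi_multAt φ).symm
  right_inv n := by
    change Multiplicative.ofAdd (Int.toNat (val (constDIV ((Multiplicative.toAdd n : ℕ) : ℤ)) (Sum.inr (0 : ℤ)))) = n
    rw [val_constDIV, Int.toNat_natCast, ofAdd_toAdd]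
  map_mul' φ ψ := by
    rw [← ofAdd_add]
    congr 1
    have hφ : (0 : ℤ) ≤ val (φ.1 s₀) (Sum.inr 0) := (φ.2.1 s₀).2 _
    have hψ : (0 : ℤ) ≤ val (ψ.1 s₀) (Sum.inr 0) := (ψ.2.1 s₀).2 _
    change Int.toNat (val (φ.1 s₀) (Sum.inr 0) + val (ψ.1 s₀) (Sum.inr 0)) = _
    rw [Int.toNat_add hφ hψ]
    rfl

/-! ### `n·Σ_j [F_j] = div₀(ϖⁿ)` with `ϖⁿ` a constant: the rank-one point -/

/-- The constant function `ϖ^c` on the point `G/G` (shear-invariant), an element of `B₀(G/G)`. [cite: MochizukiEtTh2009, Def 3.3 p.73] -/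
def cnstFn (c : ℤ) : TateTower.action.bZero top.obj :=
  ⟨fun _ => Multiplicative.ofAdd ((c, 0) : ℤ × ℤ), fun _ => trivial, fun g _ => Multiplicative.toAdd.injective (by
    change ((c, 0) : ℤ × ℤ) = Multiplicative.toAdd (shearFn (Multiplicative.toAdd g) (Multiplicative.ofAdd ((c, 0) : ℤ × ℤ)))
    rw [toAdd_shearFn, toAdd_ofAdd]
    simp)⟩

/-- `ϖ^c` is a constant (lies in `F₀(G/G)`). [cite: MochizukiEtTh2009, Def 3.3 p.73] -/
theorem cnstFn_mem_fZero (c : ℤ) : cnstFn c ∈ TateTower.action.fZero top.obj :=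
  fun _ => ⟨Multiplicative.ofAdd c, rfl⟩

/-- `div₀(ϖⁿ) = n·Σ_j [F_j]`. [cite: MochizukiEtTh2009, Def 3.3 p.73] -/
theorem div₀_cnstFn (n : ℕ) :
    TateTower.action.divZeroHom top.obj (cnstFn n) =
      Algebra.GrothendieckGroup.of (constPhi n : dm.Φ₀.obj (op top)) :=
  ((TateTower.action.divZeroHom_eq_div_iff _ _ (constPhi n) 1).2 fun s => by
    change TateTower.action.divAt top.obj (cnstFn n) s * 1 = constDIV (n : ℤ)
    rw [mul_one]
    refine Multiplicative.toAdd.injective (funext fun x => ?_)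
    change Multiplicative.toAdd (divHom (Multiplicative.ofAdd (((n : ℤ), 0) : ℤ × ℤ))) x = val (constDIV (n : ℤ)) x
    rw [toAdd_divHom, toAdd_ofAdd, val_constDIV]
    simp).trans (by simp only [map_one, div_one])

/-- **The rank-one point of the Tate tower**: `S₀ = G/G`, `Φ₀(G/G) ≅ ℕ`, every log-divisor there the divisor of a power of
the uniformiser. [cite: MochizukiEtTh2009, Def 3.3 p.73] -/
def rankOnePoint : TemperedFrobenioid.RankOnePoint TateTower.action where
  S₀ := top
  e := phiZeroTopEquivNat
  hcnst m := ⟨cnstFn (multAt m), cnstFn_mem_fZero _, by rw [div₀_cnstFn, ← eq_constPhi_multAt]⟩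

variable (R S : ((Discrete PUnit.{1})ᵒᵖ ⥤ CommMonCat.{0}) → Prop)

/-- **A tempered Frobenioid over the constructed connected Def. 3.3 (iii) data of the TATE TOWER** (weak data of
record, monoid type `ℤ`; base `pt ↦ G/G`): the `p`-adic Frobenioid of the base field of the Tate curve ([FrdII] Ex. 1.1,
[EtTh] Ex. 3.9 at the bottom of the tower). [cite: MochizukiEtTh2009, Def 3.6 p.77] -/
def temperedFrobenioid :
    TemperedFrobenioid (RealifiedDivisorMonoids.ofRlfZWeak dm hpf) (Discrete PUnit.{1}) (treeCatVocab (Discrete PUnit.{1}) R S) :=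
  TemperedFrobenioid.ofRankOnePoint TateTower.cuspLaws rankOnePoint hpf R S

/-- **NON-VACUITY at the model of record.** [cite: MochizukiEtTh2009, Def 3.6 p.77] -/
theorem nonempty_temperedFrobenioid :
    Nonempty (TemperedFrobenioid (RealifiedDivisorMonoids.ofRlfZWeak
      (DivisorMonoids.ofGaloisActionConnected TateTower.action TateTower.cuspLaws) hpf)
      (Discrete PUnit.{1}) (treeCatVocab (Discrete PUnit.{1}) R S)) :=
  ⟨temperedFrobenioid R S⟩

/-- Non-vacuity at the model of record over print's genuine base `B^temp(Π)⁰`, every topological group `Π`.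
[cite: MochizukiEtTh2009, Def 3.6 p.77] -/
theorem nonempty_temperedFrobenioid_connectedPart (Γ : Type) [Group Γ] [TopologicalSpace Γ]
    (R' S' : ((ConnectedPart (BTemp Γ))ᵒᵖ ⥤ CommMonCat.{0}) → Prop) :
    Nonempty (TemperedFrobenioid (RealifiedDivisorMonoids.ofRlfZWeak
      (DivisorMonoids.ofGaloisActionConnected TateTower.action TateTower.cuspLaws) hpf)
      (ConnectedPart (BTemp Γ)) (treeCatVocab (ConnectedPart (BTemp Γ)) R' S')) :=
  TemperedFrobenioid.nonempty_of_rankOnePoint_connectedPart TateTower.cuspLaws hpf Γ rankOnePoint R' S'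

/-! ### Instantiation tokens: the cell's hypothesis-free theorems AT THE TOWER, by name -/

/-- **«`C` IS a Frobenioid» at the tower, by abc-iut-w5-d179's hypothesis-free theorem** — INSTANTIATED (the class it
quantifies over is inhabited by `temperedFrobenioid R S`). [cite: MochizukiEtTh2009, Def 3.6 p.77] -/
theorem isFrobenioid_temperedFrobenioid_byName : PreFrobenioid.IsFrobenioid (temperedFrobenioid R S).toElem :=
  TemperedFrobenioid.isFrobenioid_ofRlfZWeak_ofGaloisActionConnected_of_isOfFSMType TateTower.action TateTower.cuspLaws hpf
    (temperedFrobenioid R S) PadicFrd.isOfFSMType_discretePUnit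

/-- **`hBinj` at the tower** (Def. 3.6 (i) binder; abc-iut-w5-d179's p439044 at `A := TateTower.action`).
[cite: MochizukiEtTh2009, Def 3.6 p.76] -/
theorem hBinj_tateTower {Y Y' : D₀ᵒᵖ} (g : Y ⟶ Y') :
    Injective ((RealifiedDivisorMonoids.ofRlfZWeak dm hpf).BΛ.map g).hom :=
  DivisorMonoids.ofGaloisActionConnected_ofRlfZWeak_hBinj TateTower.action TateTower.cuspLaws hpf g

variable (R₀ R₀' : (D₀ᵒᵖ ⥤ CommMonCat.{0}) → Prop)

/-- **`hFinv` at the tower** (GAP G-w5d135-1 binder; abc-iut-w6-d058's theorem at `A := TateTower.action`): `F₀^ℤ(Y)` is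
closed under inverses for every connected covering of the tower. [cite: MochizukiEtTh2009, Prop 3.4 p.74] -/
theorem hFinv_tateTower (Y : D₀ᵒᵖ)
    (b : (RealifiedDivisorMonoids.ofRlfZWeakOfProp34 dm (DivisorMonoids.prop34_ofGaloisActionConnected TateTower.action
      TateTower.cuspLaws R₀ R₀')).BΛ.obj Y)
    (hb : b ∈ (RealifiedDivisorMonoids.ofRlfZWeakOfProp34 dm (DivisorMonoids.prop34_ofGaloisActionConnected TateTower.action
      TateTower.cuspLaws R₀ R₀')).FΛ Y) :
    ∃ b' ∈ (RealifiedDivisorMonoids.ofRlfZWeakOfProp34 dm (DivisorMonoids.prop34_ofGaloisActionConnected TateTower.action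
      TateTower.cuspLaws R₀ R₀')).FΛ Y, b' * b = 1 :=
  DivisorMonoids.hFinv_rlfZ_ofGaloisActionConnected TateTower.action TateTower.cuspLaws R₀ R₀' Y b hb

/-- **`hP34Λ` at the tower** (GAP G-w5d124-1 binder = `Prop34Cnst.mem_FΛ_of_divΛ_eq_of`; abc-iut-w6-d058's theorem at
`A := TateTower.action`): a function with effective `Λ`-divisor is constant. [cite: MochizukiEtTh2009, Prop 3.4 p.74] -/
theorem hP34Λ_tateTower (Y : D₀ᵒᵖ)
    (b : (RealifiedDivisorMonoids.ofRlfZWeakOfProp34 dm (DivisorMonoids.prop34_ofGaloisActionConnected TateTower.action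
      TateTower.cuspLaws R₀ R₀')).BΛ.obj Y)
    (x : (RealifiedDivisorMonoids.ofRlfZWeakOfProp34 dm (DivisorMonoids.prop34_ofGaloisActionConnected TateTower.action
      TateTower.cuspLaws R₀ R₀')).ΦR.obj Y)
    (hbx : (RealifiedDivisorMonoids.ofRlfZWeakOfProp34 dm (DivisorMonoids.prop34_ofGaloisActionConnected TateTower.action
      TateTower.cuspLaws R₀ R₀')).divΛ Y b = Algebra.GrothendieckGroup.of x) :
    b ∈ (RealifiedDivisorMonoids.ofRlfZWeakOfProp34 dm (DivisorMonoids.prop34_ofGaloisActionConnected TateTower.action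
      TateTower.cuspLaws R₀ R₀')).FΛ Y :=
  DivisorMonoids.hP34Λ_rlfZ_ofGaloisActionConnected TateTower.action TateTower.cuspLaws R₀ R₀' Y b x hbx

end TateTowerFrd

end Literature.AnabelianGeometry.EtaleTheta

end
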